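import Summits.ValiantsHypothesis.ValiantsHypothesis.Theses.ProofCarryingSymmetry
import Literature.Computability.AlgebraicComplexity.DawarWilsenach2025Thm71
import HarnessLib

/-!
# ValiantsHypothesis / ProofCarryingSymmetry — `SquareSymmetricPermLB` (stmt-ValiantsHypothesis-10342)

Route `ValiantsHypothesis/ProofCarryingSymmetry`, crux `SquareSymmetricPermLB` (rank 2): Dawar–Wilsenach
2025, Theorem 7.1, in SIZE form at `F = ℂ` — for every family `(C_n)` of `S_n`-symmetric labelled
arithmetic circuits over `ℂ` (diagonal action on `Fin n × Fin n`, single fixed output) computing `per_n`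
for every `n`, there is `ε > 0` with `|C_n| ≥ 2^{ε n}` for infinitely many `n`.

The printed theorem bounds the maximal ORBIT size (`≥ 2^{ε n}` infinitely often, every field of
characteristic `0`); it is PROVED in the tree as
`Literature.Computability.AlgebraicComplexity.DawarWilsenach2025_thm71_holds`
(`DawarWilsenach2025Thm71.lean`: Thm 5.1 `DawarWilsenach2025_thm51_family`, Thm 6.4
`DawarWilsenach2025_orbitSize_countingWidth_holds`, Thm 7.2 `CFIMatching.DawarWilsenach2025_thm72_family`,
composed by the p. 19 deduction `DawarWilsenach2025_thm71_of_thm51_thm64_thm72`), and the crux is its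
size corollary `DawarWilsenach2025_thm71.size_form` (`ORB(C) ≤ |C|`, `orbitSize_le_size`) at `ℂ`.
This file is the line `registered` (birth skeleton `Cruxes/SquareSymmetricPermLB/Lines/birth.lean`)
run to the end: all three stubs were landed Literature theorems, so the closure is one term.
-/

-- `Summit.ValiantsHypothesis.ValiantsHypothesis.…` is the tree's mandated single-conjunct layout
-- (Sub = Summit), so the duplicated namespace component is intended.
set_option linter.dupNamespace false

namespace Summit.ValiantsHypothesis.ValiantsHypothesis.Theorems

open Literature.Computability.AlgebraicComplexity

/-- Settles `stmt-ValiantsHypothesis-10342` (crux `SquareSymmetricPermLB` of route ProofCarryingSymmetry):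
no family of square-symmetric labelled arithmetic circuits over `ℂ` of size `2^{o(n)}` computes the
permanent — some `ε > 0` has `2^{ε n} ≤ |C_n|` for arbitrarily large `n`. One term from the proved
Dawar–Wilsenach Theorem 7.1 (`DawarWilsenach2025_thm71_holds`, orbit-size form over every field of
characteristic `0`) through its size corollary `DawarWilsenach2025_thm71.size_form` at `F = ℂ`.
[cite: DawarWilsenach2025, Thm. 7.1 (p. 18), proof p. 19] -/
theorem squareSymmetricPermLB_proof :
    Summit.ValiantsHypothesis.ValiantsHypothesis.Theses.ProofCarryingSymmetry.SquareSymmetricPermLB := by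
  unfold Summit.ValiantsHypothesis.ValiantsHypothesis.Theses.ProofCarryingSymmetry.SquareSymmetricPermLB
  intro G _ C hs hp
  exact DawarWilsenach2025_thm71.size_form DawarWilsenach2025_thm71_holds ℂ G C hs hp

end Summit.ValiantsHypothesis.ValiantsHypothesis.Theorems
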